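import Literature.Geometry.Riemannian.PinchingEstimatesODE
import HarnessLib

/-!
# Hamilton's pinching estimates hold at `t = 0` for suitable constants (Hamilton 1997, pp. 8, 17)
(topic `Geometry/Riemannian`)

Companion of `PinchingEstimatesAlgebra.lean` in the decomposition of
`Literature.Geometry.Riemannian.hamilton_chenZhu_pinching` (`PinchingEstimates.lean`): the
elementary inequalities behind "the estimate indeed holds at `t = 0` for some constant" (Hamilton
1997, p. 8, end of the proof of Thm. 1.3: "Note that if `M⁴` is compact and `a₁ + a₂ > 0` and
`c₁ + c₂ > 0` at `t = 0`, there is some constant `Λ` so that the estimate indeed holds at `t = 0`";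
p. 17, first line of the proof of Thm. 2.3: "Clearly if `L` is large compared to `Q` and `Ω`, and
the initial maximum of the curvature, then it is true at `t = 0`"). From a bound `K₀` on the
quadratic forms `|uᵀAv|, |uᵀBv|, |uᵀCv|` (unit `u, v`) and a uniform `a₁ + a₂ ≥ m > 0`,
`c₁ + c₂ ≥ m`, each pinching set of `PinchingEstimatesODE.lean` contains `(A, B, C)` at `t = 0`
once its constants exceed explicit thresholds in `K₀, m` (`HamiltonODE.InitialFit.*`). All proved.

## References

* R. S. Hamilton, *Four-manifolds with positive isotropic curvature*, Comm. Anal. Geom. 5 (1997)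
  1–92, §2.1, p. 8 and §2.2, p. 17 (constants at `t = 0`). [Hamilton1997]
-/

noncomputable section

open Set Real
open scoped Matrix

namespace Literature.Geometry.Riemannian

namespace HamiltonODE

variable {p : Blocks}

/-! ### The estimates hold at `t = 0` for suitable constants -/

/-- `max{ln √x, Q} ≤ max{√x, Q}` (`ln y ≤ y`); used to bound the denominators of Thms. 2.1/2.3
at `t = 0`. [folklore] -/
theorem max_log_sqrt_le (x Q : ℝ) : max (log (sqrt x)) Q ≤ max (sqrt x) Q := by
  refine max_le_max_right _ ?_
  rcases (sqrt_nonneg x).eq_or_lt with h | h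
  · rw [← h]; simp
  · linarith [log_le_sub_one_of_pos h]

section InitialFit

variable {K₀ m : ℝ} (hK₀ : 0 ≤ K₀) (hm : 0 < m)
  (hbd : ∀ u v : Fin 3 → ℝ, u ⬝ᵥ u = 1 → v ⬝ᵥ v = 1 →
    |u ⬝ᵥ (p.1 *ᵥ v)| ≤ K₀ ∧ |u ⬝ᵥ (p.2.1 *ᵥ v)| ≤ K₀ ∧ |u ⬝ᵥ (p.2.2 *ᵥ v)| ≤ K₀)
  (hA : p.1.TwoSmallestEigenvaluesSumGE m) (hC : p.2.2.TwoSmallestEigenvaluesSumGE m)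

include hbd

/-- A bound `K₀` on the quadratic forms bounds `uᵀAu` from below by `-K₀`. [folklore] -/
theorem InitialFit.quadA_ge {u : Fin 3 → ℝ} (hu : u ⬝ᵥ u = 1) : -K₀ ≤ u ⬝ᵥ (p.1 *ᵥ u) :=
  (abs_le.1 (hbd u u hu hu).1).1

/-- … and `uᵀCu ≥ -K₀`. [folklore] -/
theorem InitialFit.quadC_ge {u : Fin 3 → ℝ} (hu : u ⬝ᵥ u = 1) : -K₀ ≤ u ⬝ᵥ (p.2.2 *ᵥ u) :=
  (abs_le.1 (hbd u u hu hu).2.2).1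

include hm hA hC in
/-- At `t = 0`, Thm. 1.3's inequality holds once `Λ m² ≥ 4K₀²` (Hamilton 1997, p. 8: "if `M⁴` is
compact and `a₁ + a₂ > 0` and `c₁ + c₂ > 0` at `t = 0`, there is some constant `Λ` so that the
estimate indeed holds at `t = 0`"). [cite: Hamilton1997, §2.1, Thm. 1.3 (proof, p. 8)] -/
theorem InitialFit.singularValuesSumSqLE {Λ : ℝ} (hΛ : 4 * K₀ ^ 2 ≤ Λ * m ^ 2) (hΛ0 : 0 ≤ Λ) :
    SingularValuesSumSqLE p Λ := by
  intro u₁ u₂ v₁ v₂ w w' z z' hu₁ hu₂ _ hv₁ hv₂ _ hw hw' hww' hz hz' hzz'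
  have b1 := abs_le.1 (hbd u₁ v₁ hu₁ hv₁).2.1
  have b2 := abs_le.1 (hbd u₂ v₂ hu₂ hv₂).2.1
  have hX : m ≤ w ⬝ᵥ (p.1 *ᵥ w) + w' ⬝ᵥ (p.1 *ᵥ w') := hA w w' hw hw' hww'
  have hY : m ≤ z ⬝ᵥ (p.2.2 *ᵥ z) + z' ⬝ᵥ (p.2.2 *ᵥ z') := hC z z' hz hz' hzz'
  have hsq : (u₁ ⬝ᵥ (p.2.1 *ᵥ v₁) + u₂ ⬝ᵥ (p.2.1 *ᵥ v₂)) ^ 2 ≤ 4 * K₀ ^ 2 := by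
    nlinarith
  have hXY : Λ * m ^ 2 ≤ Λ * (w ⬝ᵥ (p.1 *ᵥ w) + w' ⬝ᵥ (p.1 *ᵥ w')) *
      (z ⬝ᵥ (p.2.2 *ᵥ z) + z' ⬝ᵥ (p.2.2 *ᵥ z')) := by
    rw [mul_assoc]
    refine mul_le_mul_of_nonneg_left ?_ hΛ0
    nlinarith [hm.le]
  linarith

include hK₀ hm hA in
/-- At `t = 0`, `a₂ + a₃ ≤ Φ(a₁ + a₂)` once `Φ m ≥ 2K₀`. [cite: Hamilton1997, §2.1, Thm. 1.4 (p. 8)] -/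
theorem InitialFit.twoLargestA {Φ : ℝ} (hΦ : 2 * K₀ ≤ Φ * m) :
    p.1.TwoLargestEigenvaluesSumLE Φ := by
  intro u v w w' hu hv _ hw hw' hww'
  have b1 := abs_le.1 (hbd u u hu hu).1
  have b2 := abs_le.1 (hbd v v hv hv).1
  have hX : m ≤ w ⬝ᵥ (p.1 *ᵥ w) + w' ⬝ᵥ (p.1 *ᵥ w') := hA w w' hw hw' hww'
  nlinarith

include hK₀ hm hC in
/-- At `t = 0`, `c₂ + c₃ ≤ Φ(c₁ + c₂)` once `Φ m ≥ 2K₀`. [cite: Hamilton1997, §2.1, Thm. 1.4 (p. 8)] -/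
theorem InitialFit.twoLargestC {Φ : ℝ} (hΦ : 2 * K₀ ≤ Φ * m) :
    p.2.2.TwoLargestEigenvaluesSumLE Φ := by
  intro u v w w' hu hv _ hw hw' hww'
  have b1 := abs_le.1 (hbd u u hu hu).2.2
  have b2 := abs_le.1 (hbd v v hv hv).2.2
  have hX : m ≤ w ⬝ᵥ (p.2.2 *ᵥ w) + w' ⬝ᵥ (p.2.2 *ᵥ w') := hC w w' hw hw' hww'
  nlinarith

/-- At `t = 0`, `a₁ + ρ₁ ≥ 0` and `c₁ + ρ₁ ≥ 0` once `ρ₁ ≥ K₀`. [cite: Hamilton1997, §2.1, Thm. 1.6 (p. 10)] -/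
theorem InitialFit.smallestAddNonneg {ρ₁ : ℝ} (hρ₁ : K₀ ≤ ρ₁) :
    p.1.SmallestEigenvalueAddNonneg ρ₁ ∧ p.2.2.SmallestEigenvalueAddNonneg ρ₁ :=
  ⟨fun w hw ↦ by linarith [InitialFit.quadA_ge hbd hw],
    fun w hw ↦ by linarith [InitialFit.quadC_ge hbd hw]⟩

/-- At `t = 0`, `a₃ ≤ Ψ(a₁ + ρ)` and `c₃ ≤ Ψ(c₁ + ρ)` once `ρ ≥ K₀ + 1` and `Ψ ≥ K₀`.
[cite: Hamilton1997, §2.1, Thm. 1.7 (p. 10)] -/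
theorem InitialFit.largestLESmallestAdd {Ψ ρ : ℝ} (hρ : K₀ + 1 ≤ ρ) (hΨ : K₀ ≤ Ψ) :
    p.1.LargestLESmallestAdd Ψ ρ ∧ p.2.2.LargestLESmallestAdd Ψ ρ := by
  refine ⟨fun u w hu hw ↦ ?_, fun u w hu hw ↦ ?_⟩
  · have b1 := abs_le.1 (hbd u u hu hu).1
    have b2 := InitialFit.quadA_ge hbd hw
    nlinarith
  · have b1 := abs_le.1 (hbd u u hu hu).2.2
    have b2 := InitialFit.quadC_ge hbd hw
    nlinarith

/-- At `t = 0`, `b₃ ≤ H e^{0} √((a₁+ρ)(c₁+ρ))` once `ρ ≥ K₀ + 1` and `H ≥ K₀` (then the square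
root is `≥ 1`). [cite: Hamilton1997, §2.1, Thm. 1.9 (p. 12)] -/
theorem InitialFit.singularValueLEExp {H P ρ : ℝ} (hρ : K₀ + 1 ≤ ρ) (hH : K₀ ≤ H) :
    SingularValueLEExp p H P ρ 0 := by
  intro u v w z hu hv hw hz
  have hK₀' : 0 ≤ K₀ := (abs_nonneg _).trans (hbd u v hu hv).2.1
  have b := (abs_le.1 (hbd u v hu hv).2.1).2
  have ha := InitialFit.quadA_ge hbd hw
  have hc := InitialFit.quadC_ge hbd hz
  have h1 : 1 ≤ sqrt ((w ⬝ᵥ (p.1 *ᵥ w) + ρ) * (z ⬝ᵥ (p.2.2 *ᵥ z) + ρ)) := by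
    rw [Real.le_sqrt (by norm_num) (by nlinarith)]
    nlinarith
  simp only [mul_zero, Real.exp_zero, mul_one]
  nlinarith [mul_le_mul_of_nonneg_left h1 (hK₀'.trans hH)]

include hK₀ hm hA hC in
/-- At `t = 0`, Thm. 2.1's inequality holds once `K m ≥ 2K₀ · max{2K₀, 2}` (`K ≥ 0`): then
`(1 + K/max{ln √x, 2}) √x ≥ m + Km/max{2K₀, 2} ≥ 2K₀ ≥ 2b₃` since `m ≤ √x ≤ 2K₀`.
[cite: Hamilton1997, §2.2, Thm. 2.1 (p. 14)] -/
theorem InitialFit.improvedPinching {K : ℝ} (hK : 2 * K₀ * max (2 * K₀) 2 ≤ K * m) (hK0 : 0 ≤ K) :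
    ImprovedPinching p K := by
  intro u v w w' z z' hu hv hw hw' hww' hz hz' hzz'
  have b := (abs_le.1 (hbd u v hu hv).2.1).2
  set x := (w ⬝ᵥ (p.1 *ᵥ w) + w' ⬝ᵥ (p.1 *ᵥ w')) * (z ⬝ᵥ (p.2.2 *ᵥ z) + z' ⬝ᵥ (p.2.2 *ᵥ z'))
    with hx
  have hX : m ≤ w ⬝ᵥ (p.1 *ᵥ w) + w' ⬝ᵥ (p.1 *ᵥ w') := hA w w' hw hw' hww'
  have hY : m ≤ z ⬝ᵥ (p.2.2 *ᵥ z) + z' ⬝ᵥ (p.2.2 *ᵥ z') := hC z z' hz hz' hzz'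
  have aw := abs_le.1 (hbd w w hw hw).1
  have aw' := abs_le.1 (hbd w' w' hw' hw').1
  have cz := abs_le.1 (hbd z z hz hz).2.2
  have cz' := abs_le.1 (hbd z' z' hz' hz').2.2
  have hxlo : m ^ 2 ≤ x := by rw [hx]; nlinarith
  have hxhi : x ≤ (2 * K₀) ^ 2 := by rw [hx]; nlinarith
  have hsx_lo : m ≤ sqrt x := Real.le_sqrt_of_sq_le hxlo
  have hsx_hi : sqrt x ≤ 2 * K₀ := (Real.sqrt_le_left (by positivity)).2 hxhi
  have hM0 : 0 < max (2 * K₀) 2 := lt_max_of_lt_right two_pos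
  have hden_pos : 0 < max (log (sqrt x)) 2 := lt_max_of_lt_right two_pos
  have hden_le : max (log (sqrt x)) 2 ≤ max (2 * K₀) 2 :=
    (max_log_sqrt_le x 2).trans (max_le_max_right _ hsx_hi)
  -- `K / max{ln √x, 2} ≥ K / max{2K₀, 2}`
  have hfrac : K / max (2 * K₀) 2 ≤ K / max (log (sqrt x)) 2 :=
    div_le_div_of_nonneg_left hK0 hden_pos hden_le
  have hKm' : 2 * K₀ ≤ K / max (2 * K₀) 2 * m := by
    rw [div_mul_eq_mul_div, le_div_iff₀ hM0]
    linarith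
  have hKm : 2 * K₀ ≤ m + K / max (2 * K₀) 2 * m := by linarith
  calc 2 * (u ⬝ᵥ (p.2.1 *ᵥ v)) ≤ 2 * K₀ := by linarith
    _ ≤ m + K / max (2 * K₀) 2 * m := hKm
    _ ≤ sqrt x + K / max (log (sqrt x)) 2 * sqrt x := by gcongr
    _ = (1 + K / max (log (sqrt x)) 2) * sqrt x := by ring

include hK₀ in
/-- At `t = 0`, Thm. 2.3's inequality holds for `ρ = K₀ + 1` once `L ≥ K₀ · max{2K₀ + 1, Q}`
(`L ≥ 0`, `Q > 0`): the square root `u` lies in `[1, 2K₀ + 1]`, so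
`(1 + L/max{ln u, Q}) u ≥ 1 + L/max{2K₀+1, Q} ≥ K₀ ≥ b₃` (Hamilton 1997, p. 17: "if `L` is
large compared to `Q` … and the initial maximum of the curvature, then it is true at `t = 0`").
[cite: Hamilton1997, §2.2, Thm. 2.3 (proof, p. 17)] -/
theorem InitialFit.improvedPinchingQ {L P Q : ℝ} (hQ : 0 < Q)
    (hL : K₀ * max (2 * K₀ + 1) Q ≤ L) (hL0 : 0 ≤ L) :
    ImprovedPinchingQ p (K₀ + 1) L P Q 0 := by
  intro u v w w' hu hv hw hw'
  have b := (abs_le.1 (hbd u v hu hv).2.1).2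
  set X := (w ⬝ᵥ (p.1 *ᵥ w) + (K₀ + 1)) * (w' ⬝ᵥ (p.2.2 *ᵥ w') + (K₀ + 1)) with hXdef
  have aw := abs_le.1 (hbd w w hw hw).1
  have cw' := abs_le.1 (hbd w' w' hw' hw').2.2
  have hXlo : 1 ≤ X := by rw [hXdef]; nlinarith
  have hXhi : X ≤ (2 * K₀ + 1) ^ 2 := by rw [hXdef]; nlinarith
  have hs_lo : 1 ≤ sqrt X := by
    rw [Real.le_sqrt (by norm_num) (by linarith)]; simpa using hXlo
  have hs_hi : sqrt X ≤ 2 * K₀ + 1 := (Real.sqrt_le_left (by positivity)).2 hXhi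
  have hM0 : 0 < max (2 * K₀ + 1) Q := lt_max_of_lt_right hQ
  have hden_pos : 0 < max (log (sqrt X)) Q := lt_max_of_lt_right hQ
  have hden_le : max (log (sqrt X)) Q ≤ max (2 * K₀ + 1) Q :=
    (max_log_sqrt_le X Q).trans (max_le_max_right _ hs_hi)
  have hLe : 0 ≤ L * exp (P * 0) := by simp [hL0]
  have hfrac : L / max (2 * K₀ + 1) Q ≤ L * exp (P * 0) / max (log (sqrt X)) Q := by
    simp only [mul_zero, Real.exp_zero, mul_one]
    exact div_le_div_of_nonneg_left hL0 hden_pos hden_le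
  have hK : K₀ ≤ L / max (2 * K₀ + 1) Q := by rwa [le_div_iff₀ hM0]
  calc u ⬝ᵥ (p.2.1 *ᵥ v) ≤ K₀ := b
    _ ≤ 1 + L / max (2 * K₀ + 1) Q := by linarith
    _ ≤ (1 + L * exp (P * 0) / max (log (sqrt X)) Q) * 1 := by linarith
    _ ≤ (1 + L * exp (P * 0) / max (log (sqrt X)) Q) * sqrt X := by gcongr

end InitialFit

end HamiltonODE

end Literature.Geometry.Riemannian

end
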